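import Summits.QuantumFields.YangMills.Theorems.LuscherReductionDressedRitzPolyakovLiftBlockPositionForL
import Summits.QuantumFields.YangMills.Theorems.LuscherReductionDressedRitzPolyakovLiftBlockPositionSide
import HarnessLib

/-!
# Route `LuscherReduction`, item `DressedRitz` (stmt-QuantumFields-20205), line «polyakovlift» — the ONE-STUB option: the joint ∃-basis block text
# `BlockPlateauForL P` and ★★★ `dressedRitz_of_blockPlateau : (∀k, BlockPlateauForL (TransplantBasisLR k)) → DressedRitz` (LEAD g4; `--supports 20205`)

Skeleton r9 (8856f38b68099f4a) has three block-currency stubs, two of them ∀-basis (`stub_liftStatics`, `stub_blockLeakage`) and one ∃-basis (`stub_blockPosition`).  The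
standing disprover located what ∀-basis texts force across DEGENERATE one-site levels (cdisprove G10/G11: `TransplantBasisLR k` is closed under rotations inside a degenerate
level, so ∀-basis statics forces NORM BALANCE `|n_a − n_b| ≤ Cλ(n_a+n_b)` across mixed `E/T₂` bases — a Gram-universality demand — and ∀-basis leakage forces Ritz-value
agreement).  Since the door `OpPlat.OperatorPlateauAt k` needs ONE family only, the whole residual can be asked of ONE basis chosen by the supplier (e.g. cubic-symmetry adapted,
where cross terms between different irreps vanish EXACTLY):

* `BlockPlateauForL P` (∃-basis, block-aligned, `L`-free): for every raw vacuum there is `g ∈ P` whose dressed lifted family satisfies (o0)(o2) [`StaticClauses`], (B5)(B6)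
  [block position], and whose raw∕dressed lifts have block defects `≤ Cλ³` — the block-currency analogue of the card's `BlockPlateau` (crux idea «block-endpoint»);
* `blockPlateauForL_of_parts`: r9's three texts ⟹ the joint text (so the one-stub option is a WEAKER-OR-EQUAL demand: it drops the ∀-basis hazards and nothing else);
* ★★ `operatorPlateauAt_of_blockPlateau : BasisPhysL P → BlockPlateauForL P → OpPlat.OperatorPlateauAt k` (doors + `dynamicCoreClauses_of_block` + w1a's `block_side_package`
  ∕ `budget_C5` ∕ `budget_C6` ∕ `window_small` + `coreClauses_of_parts` + `OpPlat.operatorPlateauAt_of_unorderedCore`);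
* ★★★ `dressedRitz_of_blockPlateau : (∀ k, BlockPlateauForL (TransplantBasisLR k)) → DressedRitz`.

r10 OPTION (not registered; owner's ∕ planner's call — one joint stub removes the rotation hazards but forgoes partial landings): `DressedRitz ⟸ stub_blockPlateau :
∀ k, BlockPlateauForL (TransplantBasisLR k)`.

HONEST FRAMING: a typed joint text and its composition on the CONDITIONAL femto rung R2b1; `BlockPlateauForL (TransplantBasisLR k)` is an OPEN renormalisation-group estimate
(not in print); nothing here bears on infinite volume, the continuum limit or the Clay gap.  References: M. Lüscher, NPB 219 (1983) 233 [cite: Luscher1983, §3];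
M. Lüscher, U. Wolff, NPB 339 (1990) 222 [cite: LuscherWolff1990].
-/

set_option autoImplicit false

noncomputable section

open MeasureTheory Filter Topology Real
open Literature.MathematicalPhysics.QuantumFieldTheory (GaugeConfig Site gaugeTransform)
open scoped BigOperators

namespace Summit.QuantumFields.YangMills.Theorems.FemtoTransferGap.PolyakovLift

open Summit.QuantumFields.YangMills.Theorems.FemtoTransferGap

variable {k : ℕ}

/-! ## §1 The joint ∃-basis block text -/

/-- **BLOCK PLATEAU for the basis predicate `P`** (∃-basis, block-aligned, `L`-free): along the femto window, for every raw vacuum `φ` there is a basis `g ∈ P` such that the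
dressed lifted family `u = dressedLiftFamily β φ g` (`u_i = K^{L}v_i`, `v_i = liftVec β φ g_i`) satisfies the statics (o0)(o2) at `Cλ`, the block position (B5) at `e^{Cλ²}` and
(B6) at `Cλ²λ₀^L`, and every raw lift `v_i` and dressed lift `u_i` has block defect `≤ Cλ³` (block = `dressSteps L = L` transfer steps). OPEN (RG).
[cite: Luscher1983, §3] [cite: LuscherWolff1990] -/
def BlockPlateauForL (P : ℕ → ℝ → (Fin k → (GaugeConfig 3 1 SU2 → ℝ)) → Prop) : Prop :=
  ∃ C lam0 : ℝ, 0 ≤ C ∧ 0 < lam0 ∧ ∀ lam : ℝ, 0 < lam → lam ≤ lam0 → ∃ L0 : ℕ,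
    ∀ (L : ℕ) [NeZero L], L0 ≤ L → ∀ β : ℝ, InFemtoWindow lam β L →
      ∀ φ : GaugeConfig 3 L SU2 → ℝ, IsRawVacuum β φ →
        ∃ g : Fin k → (GaugeConfig 3 1 SU2 → ℝ), P L (luscherLambda β L) g ∧
          let u := dressedLiftFamily β φ g
          let l0 := levelValue su2Rep L β 0
          let m0 := levelValue su2Rep 1 (oneSiteCoupling β L) 0
          StaticClauses k C β u ∧
          (∀ i : Fin k,
            l2 (u i) ((transferApply β)^[dressSteps L] (u i)) * m0 ^ dressSteps L ≤
                Real.exp (C * luscherLambda β L ^ 2) * ((levelValue su2Rep 1 (oneSiteCoupling β L) ((i : ℕ) + 1) * l0) ^ dressSteps L) * l2 (u i) (u i) ∧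
            (levelValue su2Rep 1 (oneSiteCoupling β L) ((i : ℕ) + 1) * l0) ^ dressSteps L * l2 (u i) (u i) ≤
                Real.exp (C * luscherLambda β L ^ 2) * (l2 (u i) ((transferApply β)^[dressSteps L] (u i)) * m0 ^ dressSteps L)) ∧
          (∀ i l : Fin k, i ≠ l →
            |l2 (u i) ((transferApply β)^[dressSteps L] (u l)) -
                (l2 (u i) ((transferApply β)^[dressSteps L] (u i)) / l2 (u i) (u i) +
                    l2 (u l) ((transferApply β)^[dressSteps L] (u l)) / l2 (u l) (u l)) / 2 * l2 (u i) (u l)|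
              ≤ C * luscherLambda β L ^ 2 * l0 ^ dressSteps L * (Real.sqrt (l2 (u i) (u i)) * Real.sqrt (l2 (u l) (u l)))) ∧
          (∀ i : Fin k,
            l2 (liftVec β φ (g i)) ((transferApply β)^[2 * dressSteps L] (liftVec β φ (g i))) * l2 (liftVec β φ (g i)) (liftVec β φ (g i)) ≤
                (1 + C * luscherLambda β L ^ 3) * l2 (liftVec β φ (g i)) ((transferApply β)^[dressSteps L] (liftVec β φ (g i))) ^ 2 ∧
            l2 (u i) ((transferApply β)^[2 * dressSteps L] (u i)) * l2 (u i) (u i) ≤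
                (1 + C * luscherLambda β L ^ 3) * l2 (u i) ((transferApply β)^[dressSteps L] (u i)) ^ 2)

/-- r9's three texts imply the joint text (the ∃-basis of BLOCK POSITION is the witness; constants merged by `max`). [folklore] -/
theorem blockPlateauForL_of_parts {P : ℕ → ℝ → (Fin k → (GaugeConfig 3 1 SU2 → ℝ)) → Prop}
    (hS : StaticsForL P) (hBP : BlockPositionForL P) (hBL : BlockLeakageForL P) : BlockPlateauForL P := by
  obtain ⟨C₁, l₁, hC₁, hl₁, h₁⟩ := hS
  obtain ⟨C₂, l₂, hC₂, hl₂, h₂⟩ := hBP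
  obtain ⟨C₃, l₃, hC₃, hl₃, h₃⟩ := hBL
  have hC1 : C₁ ≤ max C₁ (max C₂ C₃) := le_max_left _ _
  have hC2 : C₂ ≤ max C₁ (max C₂ C₃) := (le_max_left _ _).trans (le_max_right _ _)
  have hC3 : C₃ ≤ max C₁ (max C₂ C₃) := (le_max_right _ _).trans (le_max_right _ _)
  refine ⟨max C₁ (max C₂ C₃), min l₁ (min l₂ l₃), hC₁.trans hC1, lt_min hl₁ (lt_min hl₂ hl₃), fun lam hlam hle => ?_⟩
  obtain ⟨L₁, hL₁⟩ := h₁ lam hlam (hle.trans (min_le_left _ _))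
  obtain ⟨L₂, hL₂⟩ := h₂ lam hlam (hle.trans ((min_le_right _ _).trans (min_le_left _ _)))
  obtain ⟨L₃, hL₃⟩ := h₃ lam hlam (hle.trans ((min_le_right _ _).trans (min_le_right _ _)))
  refine ⟨max L₁ (max L₂ L₃), fun L _ hL β hW φ hφ => ?_⟩
  have hle₁ : L₁ ≤ L := (le_max_left _ _).trans hL
  have hle₂ : L₂ ≤ L := ((le_max_left _ _).trans (le_max_right _ _)).trans hL
  have hle₃ : L₃ ≤ L := ((le_max_right _ _).trans (le_max_right _ _)).trans hL
  obtain ⟨g, hg, hB5, hB6⟩ := hL₂ L hle₂ β hW φ hφ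
  have hstat := hL₁ L hle₁ β hW φ hφ g hg
  have hleak := hL₃ L hle₃ β hW φ hφ g hg
  have hΛ0 : 0 ≤ luscherLambda β L := (luscherLambda_pos_of_window hlam hW).le
  have hl0 : 0 ≤ levelValue su2Rep L β 0 := levelValue_su2Rep_nonneg L (zero_le_one.trans hW.1) 0
  have hBnn : 0 ≤ oneSiteCoupling β L := by unfold oneSiteCoupling; positivity
  have hμ : ∀ j : ℕ, 0 ≤ levelValue su2Rep 1 (oneSiteCoupling β L) j := fun j => levelValue_su2Rep_nonneg 1 hBnn j
  have he : Real.exp (C₂ * luscherLambda β L ^ 2) ≤ Real.exp (max C₁ (max C₂ C₃) * luscherLambda β L ^ 2) :=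
    Real.exp_le_exp.2 (mul_le_mul_of_nonneg_right hC2 (sq_nonneg _))
  refine ⟨g, hg, ?_, fun i => ?_, fun i l hil => ?_, fun i => ?_⟩
  · obtain ⟨h0, h2⟩ := hstat
    refine ⟨h0, fun i l hil => le_trans (h2 i l hil) ?_⟩
    exact mul_le_mul_of_nonneg_right (mul_le_mul_of_nonneg_right hC1 hΛ0) (mul_nonneg (Real.sqrt_nonneg _) (Real.sqrt_nonneg _))
  · obtain ⟨ha, hb⟩ := hB5 i
    have hP : 0 ≤ (levelValue su2Rep 1 (oneSiteCoupling β L) ((i : ℕ) + 1) * levelValue su2Rep L β 0) ^ dressSteps L * l2 (dressedLiftFamily β φ g i) (dressedLiftFamily β φ g i) :=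
      mul_nonneg (pow_nonneg (mul_nonneg (hμ _) hl0) _) (l2_self_nonneg _)
    have hX : 0 ≤ l2 (dressedLiftFamily β φ g i) ((transferApply β)^[dressSteps L] (dressedLiftFamily β φ g i)) * levelValue su2Rep 1 (oneSiteCoupling β L) 0 ^ dressSteps L :=
      (mul_nonneg_iff_of_pos_left (Real.exp_pos _)).1 (le_trans hP hb)
    constructor
    · exact le_trans ha (mul_le_mul_of_nonneg_right (mul_le_mul_of_nonneg_right he (pow_nonneg (mul_nonneg (hμ _) hl0) _)) (l2_self_nonneg _))
    · exact le_trans hb (mul_le_mul_of_nonneg_right he hX)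
  · exact le_trans (hB6 i l hil) (mul_le_mul_of_nonneg_right (mul_le_mul_of_nonneg_right (mul_le_mul_of_nonneg_right hC2 (sq_nonneg _))
      (pow_nonneg hl0 _)) (mul_nonneg (Real.sqrt_nonneg _) (Real.sqrt_nonneg _)))
  · obtain ⟨hr, hd⟩ := hleak i
    have hm : 1 + C₃ * luscherLambda β L ^ 3 ≤ 1 + max C₁ (max C₂ C₃) * luscherLambda β L ^ 3 := by
      nlinarith [pow_nonneg hΛ0 3]
    exact ⟨le_trans hr (mul_le_mul_of_nonneg_right hm (sq_nonneg _)), le_trans hd (mul_le_mul_of_nonneg_right hm (sq_nonneg _))⟩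

/-! ## §2 ★★ The joint text closes `OpPlat.OperatorPlateauAt k`, hence `DressedRitz` -/

/-- Per-vector LEAKAGE (o4) from the two block defects `≤ δ = Cλ³ ≤ 1/32` through door (c) (`BlockToFine.leakage_of_blockDefects`), in the currency of
`LeakageClause` with constant `600·C`. [cite: LuscherWolff1990] -/
theorem leakageClause_of_blockDefects {L : ℕ} [NeZero L] {β : ℝ} (hβ : 0 < β) {φ : GaugeConfig 3 L SU2 → ℝ} {g : Fin k → (GaugeConfig 3 1 SU2 → ℝ)}
    (hv : ∀ i, IsPhys (liftVec β φ (g i))) {C : ℝ} (hC : 0 ≤ C) (hΛ : 0 ≤ luscherLambda β L) (hδ : C * luscherLambda β L ^ 3 ≤ 1 / 32)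
    (hleak : ∀ i : Fin k,
      l2 (liftVec β φ (g i)) ((transferApply β)^[2 * dressSteps L] (liftVec β φ (g i))) * l2 (liftVec β φ (g i)) (liftVec β φ (g i)) ≤
          (1 + C * luscherLambda β L ^ 3) * l2 (liftVec β φ (g i)) ((transferApply β)^[dressSteps L] (liftVec β φ (g i))) ^ 2 ∧
      l2 (dressedLiftFamily β φ g i) ((transferApply β)^[2 * dressSteps L] (dressedLiftFamily β φ g i)) * l2 (dressedLiftFamily β φ g i) (dressedLiftFamily β φ g i) ≤
          (1 + C * luscherLambda β L ^ 3) * l2 (dressedLiftFamily β φ g i) ((transferApply β)^[dressSteps L] (dressedLiftFamily β φ g i)) ^ 2) :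
    LeakageClause k (600 * C) β (dressedLiftFamily β φ g) := by
  intro i
  have hL1 : 1 ≤ dressSteps L := (NeZero.one_le : 1 ≤ L)
  obtain ⟨hraw, hdress⟩ := hleak i
  have hdoor := BlockToFine.leakage_of_blockDefects (ℓ := dressSteps L) hβ (hv i) hL1 (by positivity) hδ hraw hdress
  have hLL : ((dressSteps L : ℕ) : ℝ) = (L : ℝ) := rfl
  rw [dressedLiftFamily_apply]
  calc _ ≤ 600 * (C * luscherLambda β L ^ 3) / ((dressSteps L : ℕ) : ℝ) ^ 2 * levelValue su2Rep L β 0 ^ 2 *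
        l2 ((transferApply β)^[dressSteps L] (liftVec β φ (g i))) ((transferApply β)^[dressSteps L] (liftVec β φ (g i))) ^ 2 := hdoor
    _ = 600 * C * (luscherLambda β L ^ 3 / (L : ℝ) ^ 2) * levelValue su2Rep L β 0 ^ 2 *
        l2 ((transferApply β)^[dressSteps L] (liftVec β φ (g i))) ((transferApply β)^[dressSteps L] (liftVec β φ (g i))) ^ 2 := by rw [hLL]; ring

/-- ★★ **The joint block text closes the operator plateau**: `BasisPhysL P → BlockPlateauForL P → OpPlat.OperatorPlateauAt k` — PF vacuum `Ω` fed to the text; statics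
verbatim; (o5)(o6) by `dynamicCoreClauses_of_block` with the one-site side conditions of `block_side_package` and the budgets `budget_C5`/`budget_C6`; (o4) by door (c);
constants merged by `coreClauses_of_parts`; (o1),(o7) by `OpPlat.operatorPlateauAt_of_unorderedCore`. [cite: Luscher1983, §3] [cite: LuscherWolff1990] -/
theorem operatorPlateauAt_of_blockPlateau {P : ℕ → ℝ → (Fin k → (GaugeConfig 3 1 SU2 → ℝ)) → Prop} (hP : BasisPhysL P)
    (h : BlockPlateauForL P) : OpPlat.OperatorPlateauAt k := by
  obtain ⟨C, lam0, hC, hlam0, hk⟩ := h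
  obtain ⟨Θ₁, Cη, B₁, hΘ₁, hCη, hB₁, hside⟩ := block_side_package k hC
  -- the constants
  set C5 : ℝ := C + 15 * C with hC5def
  set C6 : ℝ := 2 * Θ₁ * C + 2 * Θ₁ * (Cη + 15 * C) * C +
      ((32 * (2 * Θ₁) ^ 4 + 8 * (2 * Θ₁)) * C + 128 * (2 * Θ₁) ^ 2 * (Cη + 15 * C) ^ 2) with hC6def
  set Cfin : ℝ := max C (max (max C5 C6) (600 * C)) with hCfin
  have hCfin0 : 0 ≤ Cfin := hC.trans (le_max_left _ _)
  apply OpPlat.operatorPlateauAt_of_unorderedCore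
  refine ⟨Cfin, min lam0 (min (min (1 / 2) (1 / (4 * max B₁ 1))) (1 / (256 * C + 1))), hCfin0,
    lt_min hlam0 (lt_min (lt_min (by norm_num) (by positivity)) (by positivity)), fun lam hlam hle => ?_⟩
  have hle0 : lam ≤ lam0 := hle.trans (min_le_left _ _)
  have hleW : lam ≤ min (1 / 2) (1 / (4 * max B₁ 1)) := hle.trans ((min_le_right _ _).trans (min_le_left _ _))
  have hle256 : lam ≤ 1 / (256 * C + 1) := hle.trans ((min_le_right _ _).trans (min_le_right _ _))
  have hle1 : lam ≤ 1 := by linarith [hleW.trans (min_le_left _ _)]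
  obtain ⟨L0, hL0⟩ := hk lam hlam hle0
  refine ⟨L0, fun L _ hL β hW => ?_⟩
  obtain ⟨hBge, hΛpos, hΛ1⟩ := window_small hlam hleW hW
  have hβ : 0 < β := zero_lt_one.trans_le hW.1
  obtain ⟨Ω, θ, c, hΩ, -, -, hn, heig, -, -, -⟩ := PhysL2.exists_groundState (L := L) β
  have heig' : transferApply β Ω = levelValue su2Rep L β 0 • Ω := by rw [levelValue_zero]; exact heig
  have hvac : IsRawVacuum β Ω := ⟨hΩ, hn, heig'⟩
  obtain ⟨g, hg, hstat, hB5, hB6, hleak⟩ := hL0 L hL β hW Ω hvac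
  have hgP : ∀ i, IsPhys (g i) := hP _ _ _ hg
  have hv : ∀ i, IsPhys (liftVec β Ω (g i)) := fun i => isPhys_liftVec β hΩ (hgP i)
  have hu : ∀ i, IsPhys (dressedLiftFamily β Ω g i) := fun i => isPhys_dressedLiftVec β hΩ (hgP i)
  -- δ, side conditions, budgets
  have hδ1 : C * luscherLambda β L ^ 3 ≤ 1 / 32 := C_mul_cube_le hC hlam hle1 hle256 hW.2.1 hW.2.2
  have haA : C * luscherLambda β L ^ 2 ≤ C * luscherLambda β L := by
    have : luscherLambda β L ^ 2 ≤ luscherLambda β L := by nlinarith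
    exact mul_le_mul_of_nonneg_left this hC
  obtain ⟨hcmp, hmis, htop⟩ := hside L β hβ hBge hΛpos hΛ1 (dressedLiftFamily β Ω g) (C * luscherLambda β L ^ 2) (by positivity) haA hstat.1 hB5
  have hC5 := budget_C5 (a := C * luscherLambda β L ^ 2) (δ := C * luscherLambda β L ^ 3) (CB := C) hC hΛ1 le_rfl le_rfl
  have hC6 := budget_C6 (E := C * luscherLambda β L ^ 2) (δ := C * luscherLambda β L ^ 3) (s := C * luscherLambda β L) (η := Cη * luscherLambda β L)
    (CB := C) (CS := C) hΘ₁ hC hCη hΛpos.le hΛ1 le_rfl (by positivity) le_rfl (by positivity) le_rfl (by positivity) le_rfl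
  have hpos : DynamicCoreClauses k (max C5 C6) β (dressedLiftFamily β Ω g) :=
    dynamicCoreClauses_of_block (δ := C * luscherLambda β L ^ 3) (a := C * luscherLambda β L ^ 2) (E := C * luscherLambda β L ^ 2)
      (s := C * luscherLambda β L) (Θ₁ := Θ₁) (η := Cη * luscherLambda β L) (C := max C5 C6)
      hβ hv (by positivity) hδ1 (by positivity) (by positivity) hΘ₁ (by positivity)
      (lt_of_lt_of_le hB₁ hBge) hstat.1 (fun i => (hleak i).1) (fun i => (hleak i).2) hB5 hB6 hstat.2 hcmp hmis htop
      (le_trans hC5 (mul_le_mul_of_nonneg_right (le_max_left _ _) (sq_nonneg _)))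
      (le_trans hC6 (mul_le_mul_of_nonneg_right (le_max_right _ _) (sq_nonneg _)))
  have hK : LeakageClause k (600 * C) β (dressedLiftFamily β Ω g) := leakageClause_of_blockDefects hβ hv hC hΛpos.le hδ1 hleak
  obtain ⟨c0, c2, c4, c5, c6⟩ := coreClauses_of_parts hlam hW hu (le_max_left _ _)
    ((le_max_left _ _).trans (le_max_right _ _)) ((le_max_right _ _).trans (le_max_right _ _)) hstat hpos hK
  exact ⟨Ω, hΩ, hn, heig', dressedLiftFamily β Ω g,
    ⟨fun i => fun U => dressedLiftVec β Ω (g i) U / Ω U, fun i => isPhys_div_rawVacuum β hvac (isPhys_dressedLiftVec β hΩ (hgP i)),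
      dressedLiftFamily_eq_ins β hvac hgP⟩, c0, c2, c4, c5, c6⟩

/-- ★★★ **ONE ∃-BASIS BLOCK STUB ⟹ THE CRUX**: `(∀ k, BlockPlateauForL (TransplantBasisLR k)) → DressedRitz` (r10 option of the LEAD; not registered).
[cite: Luscher1983, §3] [cite: LuscherWolff1990] -/
theorem dressedRitz_of_blockPlateau (h : ∀ k, BlockPlateauForL (TransplantBasisLR k)) :
    Summit.QuantumFields.YangMills.Theses.LuscherReduction.DressedRitz :=
  OpPlat.dressedRitz_of_operatorPlateau fun k => operatorPlateauAt_of_blockPlateau (basisPhysL_transplantBasisLR k) (h k)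

end Summit.QuantumFields.YangMills.Theorems.FemtoTransferGap.PolyakovLift

end
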